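/-
Copyright: H21 programme, solo seat `solo-RiemannHypothesis-informed` (session 4).
-/
import Summits.RiemannHypothesis.RiemannHypothesis.Theorems.SoloInformedDoubleLogMain
import Literature.NumberTheory.LFunctions.ZetaZerosProofs

/-!
# Domain of content of the double-log theorem (solo-informed, T19)

An honesty lemma for T16–T18. The local-RH hypothesis of `weilGroundEnergy_neg_of_local_doubleLog_offset`
exempts only the pair `½ ± |η| + iγ₀`; but a zero `½ + η + iγ₀` brings its conjugate `½ + η − iγ₀`,
off the line and at height distance `2|γ₀|`. Hence the hypotheses of T18 force `R ≤ 2|γ₀|`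
(`local_radius_le_two_mul_abs`), and together with `e^{c+1} ≤ R²` they force `e^{c+1} ≤ 4γ₀²`
(`exp_window_le_of_local_hypotheses`): the theorem has content only for windows
`c + 1 ≤ log(4γ₀²)`, i.e. — at the double-log threshold `c ≈ c₀(η) + log log|γ₀|/(2|η|)` — for all
sufficiently large heights `|γ₀| ≥ γ*(η)`, and is vacuous below. Nothing here is deep; it records
exactly where the conditional theorem says something.
-/

open Complex Literature.NumberTheory.LFunctions
open scoped ComplexConjugate

namespace Summit.RiemannHypothesis.RiemannHypothesis.Theorems

/-- The conjugate of a zero `½ + η + iγ₀` (`|η| < ½`) is a zero: `ζ(½ + η − iγ₀) = 0`. -/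
theorem riemannZeta_zero_conj_offset {η γ₀ : ℝ} (hη : |η| < 1 / 2)
    (hζ : riemannZeta (1 / 2 + η + γ₀ * I) = 0) : riemannZeta (1 / 2 + η + (-γ₀) * I) = 0 := by
  have hlt := abs_lt.mp hη
  have hre : (1 / 2 + η + γ₀ * I : ℂ).re = 1 / 2 + η := by simp
  have hne : (1 / 2 + η + γ₀ * I : ℂ) ≠ 1 := by
    intro h; have := congrArg Complex.re h; rw [hre] at this; simp at this; linarith
  have e : conj (1 / 2 + η + γ₀ * I : ℂ) = 1 / 2 + η + (-γ₀) * I := by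
    apply Complex.ext
    · simp
    · simp
  have hne' : (1 / 2 + η + (-γ₀) * I : ℂ) ≠ 1 := by
    intro h; have := congrArg Complex.re h; simp at this; linarith
  have hm := (riemannZetaZeroOrder_pos_iff hne).mpr hζ
  rw [← riemannZetaZeroOrder_conj_holds, e] at hm
  exact (riemannZetaZeroOrder_pos_iff hne').mp hm

/-- **The local hypothesis forces `R ≤ 2|γ₀|`.** If `ζ(½ + η + iγ₀) = 0` with `η ≠ 0`, `|η| < ½`,
`γ₀ ≠ 0`, and every off-line zero of the closed strip with `|Im ρ − γ₀| < R` is one of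
`½ ± |η| + iγ₀`, then `R ≤ 2|γ₀|` (else the conjugate zero `½ + η − iγ₀` violates the hypothesis). -/
theorem local_radius_le_two_mul_abs {η γ₀ R : ℝ} (hη0 : η ≠ 0) (hη : |η| < 1 / 2) (hγ : γ₀ ≠ 0)
    (hζ : riemannZeta (1 / 2 + η + γ₀ * I) = 0)
    (hloc : ∀ ρ : ℂ, riemannZeta ρ = 0 → 0 ≤ ρ.re → ρ.re ≤ 1 → |ρ.im - γ₀| < R → ρ.re ≠ 1 / 2 →
      ρ = 1 / 2 + ↑|η| + γ₀ * I ∨ ρ = 1 / 2 - ↑|η| + γ₀ * I) :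
    R ≤ 2 * |γ₀| := by
  by_contra hR
  push Not at hR
  have hlt := abs_lt.mp hη
  have hζ' := riemannZeta_zero_conj_offset hη hζ
  have hre : (1 / 2 + η + (-γ₀) * I : ℂ).re = 1 / 2 + η := by simp
  have him : (1 / 2 + η + (-γ₀) * I : ℂ).im = -γ₀ := by simp
  have hdist : |(1 / 2 + η + (-γ₀) * I : ℂ).im - γ₀| < R := by
    rw [him, show -γ₀ - γ₀ = -(2 * γ₀) by ring, abs_neg, abs_mul, abs_two]
    exact hR
  have h := hloc _ hζ' (by rw [hre]; linarith) (by rw [hre]; linarith) hdist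
    (by rw [hre]; intro h; apply hη0; linarith)
  rcases h with h | h
  · have := congrArg Complex.im h
    rw [him] at this; simp at this
    exact hγ (by linarith)
  · have := congrArg Complex.im h
    rw [him] at this; simp at this
    exact hγ (by linarith)

/-- **Domain of content of T18.** Under the hypotheses of
`weilGroundEnergy_neg_of_local_doubleLog_offset` (a zero `½ + η + iγ₀`, the local hypothesis of
radius `R`, and `e^{c+1} ≤ R²`) one has `e^{c+1} ≤ 4γ₀²`: the conditional double-log theorem speaks
only about windows `c + 1 ≤ log(4γ₀²)` — at the threshold, about all sufficiently large heights. -/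
theorem exp_window_le_of_local_hypotheses {η γ₀ R c : ℝ} (hη0 : η ≠ 0) (hη : |η| < 1 / 2)
    (hγ : γ₀ ≠ 0) (hR : 1 ≤ R) (hRc : Real.exp (c + 1) ≤ R ^ 2)
    (hζ : riemannZeta (1 / 2 + η + γ₀ * I) = 0)
    (hloc : ∀ ρ : ℂ, riemannZeta ρ = 0 → 0 ≤ ρ.re → ρ.re ≤ 1 → |ρ.im - γ₀| < R → ρ.re ≠ 1 / 2 →
      ρ = 1 / 2 + ↑|η| + γ₀ * I ∨ ρ = 1 / 2 - ↑|η| + γ₀ * I) :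
    Real.exp (c + 1) ≤ 4 * γ₀ ^ 2 := by
  have h := local_radius_le_two_mul_abs hη0 hη hγ hζ hloc
  have hR0 : 0 ≤ R := by linarith
  calc Real.exp (c + 1) ≤ R ^ 2 := hRc
    _ ≤ (2 * |γ₀|) ^ 2 := pow_le_pow_left₀ hR0 h 2
    _ = 4 * γ₀ ^ 2 := by rw [mul_pow, sq_abs]; norm_num

end Summit.RiemannHypothesis.RiemannHypothesis.Theorems
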